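import Literature.NumberTheory.Automorphic.AutomorphicLFunction
import Literature.NumberTheory.Automorphic.AsaiSign
import HarnessLib

/-!
# Grbac–Shahidi 2015, Theorem 4.3 (1), (2)(a): holomorphy of the partial Asai `L`-functions
# of a cuspidal representation of `GL_N(𝔸_E)`, `E/F` quadratic (named fact, `L²` currency)

Topic `NumberTheory/Automorphic`; namespace `Literature.NumberTheory.Automorphic`. This light module
(imports `AutomorphicLFunction` and `AsaiSign` only) holds ONE named fact and proves nothing:

* `GrbacShahidi2015_partialAsaiL_holomorphy` — N. Grbac, F. Shahidi, *Endoscopic transfer for unitary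
  groups and holomorphy of Asai `L`-functions*, Pacific J. Math. 276 (2015) 185–211, Theorem 4.3 (1)
  and (2)(a), HOLOMORPHY CLAUSES, for the PARTIAL Asai `L`-functions `L^S(s, Π₀, As^η)` of both signs
  `η = ±1` of every cuspidal `Π₀ ≤ L²_cusp(GL_N(E) A_G \ GL_N(𝔸_E))` (the printed normalisation, §2.A
  p. 190; the tree's `CuspidalAutomorphicRepGL N E μ` of `GLnCuspidalSpectrum` with its Satake
  families `IsSatakeFamilyOf`, `AutomorphicLFunction`): for every finite set `S` of places of `F`
  and every Satake family `A` of `Π₀` off the places above `S` for which the `c`-fixed places off `S`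
  are inert, there is `σ₀ ≥ 1` such that `s (s - 1) L^S(s, Π₀, As^η)` agrees on `{σ₀ < Re s}` with an
  ENTIRE function, and `L^S(s, Π₀, As^η)` itself does unless the family is conjugate self-dual almost
  everywhere (`A (c • w) = (A w)⁻¹` for almost all `w`).

Why this is the printed theorem.  Thm. 4.3: "(1) If `σ` is not Galois self-dual, i.e., if
`σ ≇ σ̃^θ`, then `L(s, σ, r_A)` is entire … (2) If `σ` is Galois self-dual … (a) `L(s, σ, r_A)` is
entire, except for possible simple poles at `s = 0` and `s = 1`"; here `L(s, σ, r_A)` is the complete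
Langlands–Shahidi Asai `L`-function (p. 191), and `L(s, σ ⊗ δ̂, r_A) = L(s, σ, As⁻)` (p. 206; Mok 2015
§2.5 p. 20), so both signs are covered by applying the theorem to `σ` and to `σ ⊗ δ̂` (again cuspidal,
normalised, Galois self-dual iff `σ` is).  The partial function differs from the complete one by the
finitely many reciprocal local factors at `S` and at infinity, which are entire (reciprocal
Langlands–Shahidi factors are polynomials in `q_v^{-s}`, reciprocal archimedean factors are reciprocal
Gamma products), so `s (s - 1) L^S` is entire in case (2)(a) and `L^S` is entire in case (1); "Galois
self-dual" `σ^θ ≅ σ̃` is, by strong multiplicity one, the almost-everywhere conjugate self-duality of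
the Satake family used here.  Like all of Grbac–Shahidi §4 (and Mok 2015) the printed proof rests on
the endoscopic classification for quasi-split unitary groups, i.e. on the stabilisation of the
twisted trace formula (loc. cit. p. 186); for `As⁺` the statement is also Flicker's theorem
(Flicker 1988, Theorem p. 297; Flicker–Zinoviev 1995).

This is, VERBATIM, the hypothesis `hGS` of the accepted theorems
`Mok2014_partialAsaiL_continuation_pole_dichotomy_of_asaiHolomorphy_of_L2`
(`AsaiSignContOfAsaiHolomorphy.lean`) and, through `asaiHolomorphyReGeOne_of_asaiHolomorphy`, of
`GrbacShahidi2015_partialAsaiL_at_one_of_asaiHolomorphyReGeOne_of_L2` (`AsaiAtOneOfAsaiHolomorphy.lean`),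
which close the named facts `Mok2014_partialAsaiL_continuation_pole_dichotomy` and
`GrbacShahidi2015_partialAsaiL_at_one` modulo this fact and the Jacquet–Shalika / multiplicity-one
facts (`JacquetShalika1981_partialPairL_at_one_of_ne_conj`, `…_boundary_of_ne_one`,
`…_pole_of_eq_conj`, `multiplicity_one_gl`).  Vendored by the librarian (sweep g27) at the request of
the proving seats (promote events 3493820, 3506136), which may not file named facts themselves.

Deliberately NOT here: the non-vanishing clauses of Thm. 4.3 (they are what the two theorems above
DERIVE at `s = 1`), clause (2)(b) (which sign carries the pole: `TwistedAsaiPole.lean`), and any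
statement about the complete `L`-function or the archimedean factors.

## References

* [GrbacShahidi2015] N. Grbac, F. Shahidi, Pacific J. Math. 276 (2015) 185–211: Thm. 4.3 (1), (2)(a)
  pp. 190–191, proof pp. 204–206, Remark 4.2, §4.A, §4.C.
* [Mok2014] C. P. Mok, Mem. AMS 235 (2015), §2.5 p. 20 (Asai `L`-functions of both signs).
* [Flicker1988] Y. Flicker, Bull. SMF 116 (1988), Theorem p. 297.
-/

noncomputable section

open scoped MatrixGroups
open NumberField IsDedekindDomain MeasureTheory Filter

namespace Literature.NumberTheory.Automorphic

open AdelicGroupData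

/-- **Grbac–Shahidi 2015, Thm. 4.3 (1), (2)(a) — holomorphy of the partial Asai `L`-functions, both
signs, `L²` currency.**  For a quadratic extension `E/F` of number fields with non-trivial automorphism
`c`, a cuspidal `Π₀ ≤ L²_cusp(GL_N(𝔸_E))` (`N ≥ 1`, any automorphic measure), a finite set `S` of
places of `F`, a Satake family `A` of `Π₀` off the places of `E` above `S` such that the `c`-fixed
places off `S` are inert, and a sign `η`: there is `σ₀ ≥ 1` such that (i) some ENTIRE `G` satisfies
`G(s) = s (s - 1) L^S(s, Π₀, As^η)` for `Re s > σ₀`, and (ii) if the family is NOT conjugate self-dual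
almost everywhere then some ENTIRE `H` satisfies `H(s) = L^S(s, Π₀, As^η)` for `Re s > σ₀`.
Printed: "(1) If `σ` is not Galois self-dual … `L(s, σ, r_A)` is entire. (2) If `σ` is Galois
self-dual … (a) `L(s, σ, r_A)` is entire, except for possible simple poles at `s = 0` and `s = 1`",
applied to `σ` and `σ ⊗ δ̂` (`L(s, σ ⊗ δ̂, r_A) = L(s, σ, As⁻)`) and passed to the partial functions
(finitely many entire reciprocal local factors); conditional in print on the stabilisation of the
twisted trace formula (p. 186).  Verbatim the hypothesis `hGS` of
`Mok2014_partialAsaiL_continuation_pole_dichotomy_of_asaiHolomorphy_of_L2` and (via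
`asaiHolomorphyReGeOne_of_asaiHolomorphy`) of
`GrbacShahidi2015_partialAsaiL_at_one_of_asaiHolomorphyReGeOne_of_L2`.
[cite: GrbacShahidi2015, Thm. 4.3 (1), (2)(a), pp. 190–191 and 204–206, Remark 4.2, §4.C] -/
def GrbacShahidi2015_partialAsaiL_holomorphy : Prop :=
  ∀ (F E : Type) [Field F] [NumberField F] [Field E] [NumberField E] [Algebra F E]
    (c : E ≃ₐ[F] E), Module.finrank F E = 2 → c ≠ 1 →
    ∀ (N : ℕ) (μ : Measure (gl N E).automorphicQuotient) [(gl N E).IsAutomorphicMeasure μ]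
      (P : CuspidalAutomorphicRepGL N E μ), 0 < N →
      ∀ (S : Set (HeightOneSpectrum (𝓞 F))) (A : SatakeFamily E) (η : ℤˣ), S.Finite →
        IsSatakeFamilyOf P {w : HeightOneSpectrum (𝓞 E) | w.under (𝓞 F) ∈ S} A →
        (∀ w : HeightOneSpectrum (𝓞 E), w.under (𝓞 F) ∉ S → c • w = w →
          w.asIdeal.inertiaDeg (𝓞 F) = 2) →
        ∃ σ₀ : ℝ, 1 ≤ σ₀ ∧
          (∃ G : ℂ → ℂ, Differentiable ℂ G ∧
            ∀ s : ℂ, σ₀ < s.re → G s = s * (s - 1) * partialAsaiL S c A η s) ∧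
          ((¬ ∀ᶠ w : HeightOneSpectrum (𝓞 E) in cofinite, A (c • w) = (A w).map (·⁻¹)) →
            ∃ H : ℂ → ℂ, Differentiable ℂ H ∧
              ∀ s : ℂ, σ₀ < s.re → H s = partialAsaiL S c A η s)

/-- Sanity link (statement identity): the named fact IS the hypothesis `hGS` consumed by the accepted
reductions — any inhabitant feeds `Mok2014_partialAsaiL_continuation_pole_dichotomy_of_asaiHolomorphy_of_L2`
verbatim (checked here only as a re-typing, since that theorem lives in a heavier module). [folklore] -/
theorem GrbacShahidi2015_partialAsaiL_holomorphy.elim (h : GrbacShahidi2015_partialAsaiL_holomorphy)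
    (F E : Type) [Field F] [NumberField F] [Field E] [NumberField E] [Algebra F E]
    (c : E ≃ₐ[F] E) (h2 : Module.finrank F E = 2) (hc : c ≠ 1)
    (N : ℕ) (μ : Measure (gl N E).automorphicQuotient) [(gl N E).IsAutomorphicMeasure μ]
    (P : CuspidalAutomorphicRepGL N E μ) (hN : 0 < N)
    (S : Set (HeightOneSpectrum (𝓞 F))) (A : SatakeFamily E) (η : ℤˣ) (hS : S.Finite)
    (hA : IsSatakeFamilyOf P {w : HeightOneSpectrum (𝓞 E) | w.under (𝓞 F) ∈ S} A)
    (hin : ∀ w : HeightOneSpectrum (𝓞 E), w.under (𝓞 F) ∉ S → c • w = w →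
      w.asIdeal.inertiaDeg (𝓞 F) = 2) :
    ∃ σ₀ : ℝ, 1 ≤ σ₀ ∧
      (∃ G : ℂ → ℂ, Differentiable ℂ G ∧
        ∀ s : ℂ, σ₀ < s.re → G s = s * (s - 1) * partialAsaiL S c A η s) ∧
      ((¬ ∀ᶠ w : HeightOneSpectrum (𝓞 E) in cofinite, A (c • w) = (A w).map (·⁻¹)) →
        ∃ H : ℂ → ℂ, Differentiable ℂ H ∧
          ∀ s : ℂ, σ₀ < s.re → H s = partialAsaiL S c A η s) :=
  h F E c h2 hc N μ P hN S A η hS hA hin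

end Literature.NumberTheory.Automorphic
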